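import Mathlib
import Literature.MathematicalPhysics.QuantumFieldTheory.TorusPlaquetteNeighbours
import Literature.MathematicalPhysics.QuantumFieldTheory.PlaquetteWeightTorusSpecification
import Literature.Probability.LatticeModels.DobrushinTiltOscillation
import Literature.Probability.LatticeModels.DobrushinTiltSharp
import HarnessLib

/-!
# Dobrushin's uniqueness regime for plaquette-weight lattice gauge measures on tori:
# exponential clustering uniformly in the volume

Dobrushin's contraction technique in the total-variation (discrete Vasserstein) form
(Dobrushin 1968/1970; Föllmer, LNM 1362 (1988), Ch. I §2, Thm. (2.13) with Remark (2.17);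
Künsch, CMP 84 (1982); Georgii 2011, §8.2), run on the torus weight specification
`torusWeightSpec v` (`PlaquetteWeightTorusSpecification.lean`) of a GENERAL continuous positive
single-plaquette weight `v : G → ℝ` on a compact group `G`:

* `siteLaw_torusWeightSpec_eq_tilted_local`, `siteLaw_torusWeightSpec_congr` — the one-link
  conditional law is the Haar tilt by the LOCAL energy `∑_{q ∋ e} log v((ω^{e←g})_q)`; finite range
  over the plaquette neighbours `linkNbrT e` (`TorusPlaquetteNeighbours.lean`).
* `siteLaw_torusWeightSpec_contract`, `isKRContraction_torusWeightSpec` — **Dobrushin's condition**: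
  with `δ = osc (log v)`, a boundary change at one neighbour `y` moves the local energy by at most
  `k(e,y) δ` (`k` = joint-plaquette multiplicity), hence (`DobrushinTiltOscillation.lean` + convexity)
  the law of `U_e` by at most `C e y = (k(e,y)/(4(d−1)))(e^{4(d−1)δ} − 1)` in total variation; row
  sums `≤ (3/2)(e^{4(d−1)δ} − 1)` since `∑_y k(e,y) ≤ 6(d−1)` (`sum_linkNbrT_coeff_le`).
* `abs_integral_mul_sub_le_torusDobrushin` — the abstract covariance estimate
  `DobrushinMetric.abs_covariance_le_of_isKRContraction` for the (Gibbs) plaquette-weight torus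
  measure, and
* `plaquetteWeight_torusClustering_dobrushin` — **exponential clustering uniformly in the volume
  and the displacement** for bounded measurable local observables of `ℤ^d` read through the periodic
  lift, in the shape of `plaquetteWeight_torusClustering_uniform_of_log_le`
  (`PlaquetteWeightTorusClustering.lean`, the Osterwalder–Seiler cluster expansion, whose radius is
  `betaR 1 (3^d d²)/4 ≈ 10^(−672.8)` for `d = 4`): here the hypothesis is
  `(3/2)(e^{4(d−1) osc(log v)} − 1) < 1`, i.e. `osc (log v) < log(5/3)/12 ≈ 4.26·10⁻²` for `d = 4`,
  with mass `m = −log max(c_δ, 1/2)` and profile `ℓ = ` periodic sup-distance to the support of the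
  translated observable (`exists_linkProfile`).

Everything is proved; no named facts. Consumed by the `PathGapModulus` crux of the Yang–Mills
`GronwallGap` route (verified strong-coupling region of the path-gap modulus).

LINEAR TWINS (Simon's lemma `DobrushinMetric.abs_integral_tilted_sub_integral_tilted_le_linear`,
Simon CMP 68 (1979), in place of the exponential tilt bound): the one-link coefficient becomes
`C e y = k(e,y) δ / 2` (`siteLaw_torusWeightSpec_contract_linear`,
`isKRContraction_torusWeightSpec_linear`), the row sums `≤ 3(d−1) δ`
(`sum_linkNbrT_coeff_le_linear`), and the clustering theorem holds under `3(d−1) δ < 1`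
(`plaquetteWeight_torusClustering_dobrushin_linear`; `d = 4`: `osc (log v) < 1/9 ≈ 0.111` instead
of `log(5/3)/12 ≈ 4.26·10⁻²`; weights `e^{−β c}`, `|c| ≤ 1`: `6(d−1)|β| < 1`, i.e. `|β| < 1/18` for
`d = 4`, `plaquetteWeight_torusClustering_dobrushin_exp_linear`), through the coefficient-generic
forms `abs_integral_mul_sub_le_torusDobrushin_of_isKRContraction` and
`plaquetteWeight_torusClustering_of_isKRContraction`.

## References
* R. L. Dobrushin, Theory Probab. Appl. 13 (1968) 197–224; 15 (1970) 458–486.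
* H. Föllmer, *Random fields and diffusion processes*, LNM 1362 (1988), Ch. I §2.
* H. Künsch, CMP 84 (1982) 207–222.
* H.-O. Georgii, *Gibbs Measures and Phase Transitions*, 2nd ed. (2011), §8.1–8.2.
* E. Seiler, LNP 159 (1982), Ch. 2.
* H. Shen, R. Zhu, X. Zhu, CMP 400 (2023) 805–851, §2 (plaquette neighbours of a link).
-/

noncomputable section

namespace Literature.MathematicalPhysics.QuantumFieldTheory

open MeasureTheory Filter Topology ProbabilityTheory Function Real Finset
open Literature.Probability.LatticeModels Literature.Probability.LatticeModels.DobrushinMetric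
open Literature.MathematicalPhysics.QuantumLattice (toTorusObservable
  IsCylinder IsLocalObservable LGConfig torusLift torusEdge groupHeatKernelMeasure
  groupHeatKernelMeasure_eq groupHeatKernelWeight)

section OneLink

variable {d L : ℕ} [NeZero L] {G : Type*} [Group G] [TopologicalSpace G] [IsTopologicalGroup G]
  [CompactSpace G] [MeasurableSpace G] [BorelSpace G]

omit [NeZero L] [TopologicalSpace G] [IsTopologicalGroup G] [CompactSpace G] [MeasurableSpace G]
  [BorelSpace G] in
/-- Updating a link not on the plaquette does not change the plaquette holonomy. [folklore] -/
theorem plaquetteHolonomy_update_of_not_mem {q : Plaquette d L} {e : Edge d L}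
    (he : e ∉ plaqEdgesT q) (ω : GaugeConfig d L G) (g : G) :
    plaquetteHolonomy (update ω e g) q.1 q.2.1.1 q.2.1.2 = plaquetteHolonomy ω q.1 q.2.1.1 q.2.1.2 :=
  dependsOn_plaquetteHolonomy q fun z hz => by
    rw [update_of_ne]
    rintro rfl
    exact he hz

omit [TopologicalSpace G] [IsTopologicalGroup G] [CompactSpace G] [MeasurableSpace G] [BorelSpace G] in
/-- **The torus energy splits at a link**: `∑_q log v((ω^{e←g})_q)` is the local energy over the
plaquettes through `e` plus a term not depending on `g`. [cite: SeilerLNP1982, Ch. 2] -/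
theorem torusLogWeight_update_eq (v : G → ℝ) (e : Edge d L)
    (ω : GaugeConfig d L G) (g : G) :
    torusLogWeight v (update ω e g) =
      (∑ q ∈ (plaqsThrough e)ᶜ, Real.log (v (plaquetteHolonomy ω q.1 q.2.1.1 q.2.1.2))) +
        ∑ q ∈ plaqsThrough e, Real.log (v (plaquetteHolonomy (update ω e g) q.1 q.2.1.1 q.2.1.2)) := by
  unfold torusLogWeight
  rw [← sum_compl_add_sum (plaqsThrough e)]
  congr 1
  refine sum_congr rfl fun q hq => ?_
  rw [mem_compl, mem_plaqsThrough] at hq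
  rw [plaquetteHolonomy_update_of_not_mem hq]

variable [SecondCountableTopology G]

/-- **The one-link law is the Haar tilt by the LOCAL energy** `∑_{q ∋ e} log v((ω^{e←g})_q)`
(the plaquettes away from `e` cancel in the normalisation). [cite: SeilerLNP1982, Ch. 2] -/
theorem siteLaw_torusWeightSpec_eq_tilted_local {v : G → ℝ}
    (hv : Continuous v) (e : Edge d L) (ω : GaugeConfig d L G) :
    siteLaw (torusWeightSpec v) e ω = (haarProbability G).tilted fun g =>
      ∑ q ∈ plaqsThrough e, Real.log (v (plaquetteHolonomy (update ω e g) q.1 q.2.1.1 q.2.1.2)) := by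
  rw [siteLaw_torusWeightSpec_eq_tilted_haar hv e ω]
  simp_rw [torusLogWeight_update_eq v e ω]
  set c : ℝ := ∑ q ∈ (plaqsThrough e)ᶜ, Real.log (v (plaquetteHolonomy ω q.1 q.2.1.1 q.2.1.2))
  have h := tilted_tilted (μ := haarProbability G) (f := fun _ : G => c) (integrable_const (exp c))
    (fun g => ∑ q ∈ plaqsThrough e, Real.log (v (plaquetteHolonomy (update ω e g) q.1 q.2.1.1 q.2.1.2)))
  rw [tilted_const] at h
  rw [h]
  rfl

/-- **Finite range of the torus weight specification at one link**: the conditional law of `U_e`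
depends on the other links only through the plaquette neighbours `linkNbrT e`.
[cite: SeilerLNP1982, Ch. 2] -/
theorem siteLaw_torusWeightSpec_congr {v : G → ℝ} (hv : Continuous v) (e : Edge d L)
    {η η' : GaugeConfig d L G} (h : ∀ z ∈ linkNbrT e, η z = η' z) :
    siteLaw (torusWeightSpec v) e η = siteLaw (torusWeightSpec v) e η' := by
  rw [siteLaw_torusWeightSpec_eq_tilted_local hv, siteLaw_torusWeightSpec_eq_tilted_local hv]
  congr 1
  funext g
  refine sum_congr rfl fun q hq => ?_
  rw [mem_plaqsThrough] at hq
  congr 2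
  refine dependsOn_plaquetteHolonomy q fun z hz => ?_
  by_cases hze : z = e
  · subst hze; simp
  · rw [update_of_ne hze, update_of_ne hze]
    exact h z (mem_linkNbrT_iff.2 ⟨hze, q, hq, hz⟩)

omit [TopologicalSpace G] [IsTopologicalGroup G] [CompactSpace G] [MeasurableSpace G] [BorelSpace G]
  [SecondCountableTopology G] in
/-- **One-link perturbation of the local energy**: if `ω = η` off the link `y ≠ e` and
`osc (log v) ≤ δ`, the local energies at `e` differ by at most `k(e,y) δ`, `k(e,y)` the number of
plaquettes containing both links. [cite: arXiv220412737, §2] -/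
theorem abs_localEnergy_sub_le {v : G → ℝ} {δ : ℝ}
    (hvδ : ∀ a b, |Real.log (v a) - Real.log (v b)| ≤ δ) (e : Edge d L) {y : Edge d L} (hye : y ≠ e)
    {ω η : GaugeConfig d L G} (hωη : ∀ z, z ≠ y → ω z = η z) (g : G) :
    |(∑ q ∈ plaqsThrough e, Real.log (v (plaquetteHolonomy (update ω e g) q.1 q.2.1.1 q.2.1.2))) -
        ∑ q ∈ plaqsThrough e, Real.log (v (plaquetteHolonomy (update η e g) q.1 q.2.1.1 q.2.1.2))| ≤
      jointPlaq e y * δ := by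
  have hδ0 : 0 ≤ δ := (abs_nonneg _).trans (hvδ 1 1)
  rw [← sum_sub_distrib]
  refine (abs_sum_le_sum_abs _ _).trans ?_
  have hterm : ∀ q ∈ plaqsThrough e,
      |Real.log (v (plaquetteHolonomy (update ω e g) q.1 q.2.1.1 q.2.1.2)) -
        Real.log (v (plaquetteHolonomy (update η e g) q.1 q.2.1.1 q.2.1.2))| ≤
      if y ∈ plaqEdgesT q then δ else 0 := by
    intro q _
    split_ifs with hyq
    · exact hvδ _ _
    · have hh : plaquetteHolonomy (update ω e g) q.1 q.2.1.1 q.2.1.2 =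
          plaquetteHolonomy (update η e g) q.1 q.2.1.1 q.2.1.2 := by
        refine dependsOn_plaquetteHolonomy q fun z hz => ?_
        by_cases hze : z = e
        · subst hze; simp
        · rw [update_of_ne hze, update_of_ne hze]
          refine hωη z ?_
          rintro rfl
          exact hyq hz
      rw [hh, sub_self, abs_zero]
  refine (sum_le_sum hterm).trans ?_
  rw [← sum_filter, sum_const, nsmul_eq_mul]
  rfl

omit [NeZero L] [TopologicalSpace G] [IsTopologicalGroup G] [CompactSpace G] [MeasurableSpace G]
  [BorelSpace G] [SecondCountableTopology G] [Group G] in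
/-- Convexity: `e^{kt} − 1 ≤ (k/K)(e^{Kt} − 1)` for `0 ≤ k ≤ K`, `0 < K`, `0 ≤ t`. [folklore] -/
theorem exp_mul_sub_one_le_div_mul {k K t : ℝ} (hk0 : 0 ≤ k) (hkK : k ≤ K) (hK : 0 < K) (ht : 0 ≤ t) :
    exp (k * t) - 1 ≤ k / K * (exp (K * t) - 1) := by
  have hconv := convexOn_exp.2 (Set.mem_univ 0) (Set.mem_univ (K * t))
    (show 0 ≤ 1 - k / K from sub_nonneg.2 ((div_le_one hK).2 hkK)) (div_nonneg hk0 hK.le)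
    (by ring)
  simp only [smul_eq_mul, mul_zero, zero_add, exp_zero, mul_one] at hconv
  have hkt : k / K * (K * t) = k * t := by field_simp
  rw [hkt] at hconv
  have _ := ht
  linarith

/-- **The one-link total-variation contraction** of the torus weight specification: for
`osc (log v) ≤ δ`, a boundary change at one plaquette neighbour `y` of `e` moves the law of `U_e`,
tested on bounded measurable `φ` of oscillation `≤ L'`, by at most
`(k(e,y)/(4(d−1))) (e^{4(d−1)δ} − 1) · L'` (Dobrushin's coefficient in the discrete metric:
Föllmer 1988, Ch. I, Remark (2.17); Georgii 2011, Prop. 8.8). [cite: Follmer1988, Ch. I Remark (2.17)] -/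
theorem siteLaw_torusWeightSpec_contract (hd : 2 ≤ d) {v : G → ℝ} (hv : Continuous v)
    (hv0 : ∀ g, 0 < v g) {δ : ℝ} (hvδ : ∀ a b, |Real.log (v a) - Real.log (v b)| ≤ δ)
    (e : Edge d L) {y : Edge d L} (hy : y ∈ linkNbrT e) {ω η : GaugeConfig d L G}
    (hωη : ∀ z, z ≠ y → ω z = η z) {φ : G → ℝ} (hφm : Measurable φ) (hφb : ∃ M, ∀ s, |φ s| ≤ M)
    {L' : ℝ} (hL' : 0 ≤ L') (hφL : ∀ a b, |φ a - φ b| ≤ L') :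
    |∫ s, φ s ∂(siteLaw (torusWeightSpec v) e ω) - ∫ s, φ s ∂(siteLaw (torusWeightSpec v) e η)| ≤
      (jointPlaq e y / (4 * (d - 1 : ℕ)) * (exp (4 * (d - 1 : ℕ) * δ) - 1)) * L' := by
  have hδ0 : 0 ≤ δ := (abs_nonneg _).trans (hvδ 1 1)
  have hye : y ≠ e := (mem_linkNbrT_iff.1 hy).1
  rw [siteLaw_torusWeightSpec_eq_tilted_local hv, siteLaw_torusWeightSpec_eq_tilted_local hv]
  -- measurability and boundedness of the local energies
  have hmeas : ∀ τ : GaugeConfig d L G, Measurable fun g =>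
      ∑ q ∈ plaqsThrough e, Real.log (v (plaquetteHolonomy (update τ e g) q.1 q.2.1.1 q.2.1.2)) :=
    fun τ => Finset.measurable_sum _ fun q _ =>
      (hv.measurable.comp ((measurable_plaquetteHolonomy _ _ _).comp (measurable_update τ))).log
  obtain ⟨B, hB⟩ : ∃ B, ∀ g : G, |Real.log (v g)| ≤ B := by
    obtain ⟨C, hC⟩ := isCompact_univ.exists_bound_of_continuousOn
      ((hv.log fun g => (hv0 g).ne').continuousOn)
    exact ⟨C, fun g => by simpa [Real.norm_eq_abs] using hC g (Set.mem_univ g)⟩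
  have hbdd : ∀ τ : GaugeConfig d L G, ∃ B', ∀ g : G,
      |∑ q ∈ plaqsThrough e, Real.log (v (plaquetteHolonomy (update τ e g) q.1 q.2.1.1 q.2.1.2))| ≤ B' :=
    fun τ => ⟨∑ _q ∈ plaqsThrough e, B, fun g => (abs_sum_le_sum_abs _ _).trans
      (sum_le_sum fun q _ => hB _)⟩
  have key := abs_integral_tilted_sub_integral_tilted_le (haarProbability G) (hmeas ω) (hmeas η)
    (hbdd ω) (hbdd η) (κ := 0) (ε := jointPlaq e y * δ)
    (fun g => by rw [sub_zero]; exact abs_localEnergy_sub_le hvδ e hye hωη g) hφm hφb hφL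
  refine key.trans (mul_le_mul_of_nonneg_right ?_ hL')
  -- `½ (e^{2kδ} − 1) ≤ (k / (4(d−1))) (e^{4(d−1)δ} − 1)` by convexity, `k ≤ 2(d−1)`
  have hK : (0 : ℝ) < 2 * (d - 1 : ℕ) := by
    have : (1 : ℝ) ≤ (d - 1 : ℕ) := by exact_mod_cast (show 1 ≤ d - 1 by omega)
    linarith
  have hk : (jointPlaq e y : ℝ) ≤ 2 * (d - 1 : ℕ) := by exact_mod_cast jointPlaq_le e y
  have hconv := exp_mul_sub_one_le_div_mul (k := jointPlaq e y) (K := 2 * (d - 1 : ℕ)) (t := 2 * δ)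
    (Nat.cast_nonneg _) hk hK (by linarith)
  have e1 : (jointPlaq e y : ℝ) * (2 * δ) = 2 * (jointPlaq e y * δ) := by ring
  have e2 : (2 * (d - 1 : ℕ) : ℝ) * (2 * δ) = 4 * (d - 1 : ℕ) * δ := by ring
  rw [e1, e2] at hconv
  have e3 : (jointPlaq e y : ℝ) / (4 * (d - 1 : ℕ)) * (exp (4 * (d - 1 : ℕ) * δ) - 1) =
      (jointPlaq e y / (2 * (d - 1 : ℕ)) * (exp (4 * (d - 1 : ℕ) * δ) - 1)) / 2 := by ring
  rw [e3]
  linarith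

/-- **Dobrushin's condition (total-variation form) for the torus weight specification**: for
`osc (log v) ≤ δ` the specification is a Kantorovich–Rubinstein contraction for the discrete weight
`r ≡ 1` over the plaquette neighbours, with coefficients
`C e y = (k(e,y)/(4(d−1))) (e^{4(d−1)δ} − 1)` whose row sums are `≤ (3/2)(e^{4(d−1)δ} − 1)`
(`∑_y k(e,y) ≤ 6(d−1)`). [cite: Follmer1988, Ch. I (2.20)] -/
theorem isKRContraction_torusWeightSpec (hd : 2 ≤ d) {v : G → ℝ} (hv : Continuous v)
    (hv0 : ∀ g, 0 < v g) {δ : ℝ} (hvδ : ∀ a b, |Real.log (v a) - Real.log (v b)| ≤ δ) :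
    IsKRContraction (torusWeightSpec (d := d) (L := L) v) (fun _ _ => (1 : ℝ)) linkNbrT
      fun e y => jointPlaq e y / (4 * (d - 1 : ℕ)) * (exp (4 * (d - 1 : ℕ) * δ) - 1) := by
  have hδ0 : 0 ≤ δ := (abs_nonneg _).trans (hvδ 1 1)
  refine ⟨not_mem_linkNbrT, fun e y => ?_, fun e η η' h => siteLaw_torusWeightSpec_congr hv e h,
    fun e y hy ω η hωη φ L' hφm hφb hL' hφL => ?_⟩
  · exact mul_nonneg (div_nonneg (Nat.cast_nonneg _) (by positivity))
      (sub_nonneg.2 (one_le_exp (by positivity)))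
  · rw [mul_one]
    exact siteLaw_torusWeightSpec_contract hd hv hv0 hvδ e hy hωη hφm hφb hL'
      (fun a b => by simpa using hφL a b)

omit [TopologicalSpace G] [IsTopologicalGroup G] [CompactSpace G] [MeasurableSpace G] [BorelSpace G]
  [SecondCountableTopology G] [Group G] in
/-- Row sums of the Dobrushin coefficients: `∑_{y ∈ nbr e} C e y ≤ (3/2)(e^{4(d−1)δ} − 1)`.
[cite: arXiv220412737, §2] -/
theorem sum_linkNbrT_coeff_le (hd : 2 ≤ d) {δ : ℝ} (hδ0 : 0 ≤ δ) (e : Edge d L) :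
    ∑ y ∈ linkNbrT e, (jointPlaq e y : ℝ) / (4 * (d - 1 : ℕ)) * (exp (4 * (d - 1 : ℕ) * δ) - 1) ≤
      3 / 2 * (exp (4 * (d - 1 : ℕ) * δ) - 1) := by
  have hD : (0 : ℝ) < (d - 1 : ℕ) := by exact_mod_cast (show 0 < d - 1 by omega)
  have hE : 0 ≤ exp (4 * (d - 1 : ℕ) * δ) - 1 := sub_nonneg.2 (one_le_exp (by positivity))
  have hterm : ∀ y, (jointPlaq e y : ℝ) / (4 * (d - 1 : ℕ)) * (exp (4 * (d - 1 : ℕ) * δ) - 1) =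
      (jointPlaq e y : ℝ) * ((exp (4 * (d - 1 : ℕ) * δ) - 1) / (4 * (d - 1 : ℕ))) := fun y => by ring
  simp_rw [hterm, ← sum_mul]
  calc (∑ y ∈ linkNbrT e, (jointPlaq e y : ℝ)) * ((exp (4 * (d - 1 : ℕ) * δ) - 1) / (4 * (d - 1 : ℕ)))
      ≤ (6 * (d - 1 : ℕ)) * ((exp (4 * (d - 1 : ℕ) * δ) - 1) / (4 * (d - 1 : ℕ))) :=
        mul_le_mul_of_nonneg_right (sum_jointPlaq_le e) (by positivity)
    _ = 3 / 2 * (exp (4 * (d - 1 : ℕ) * δ) - 1) := by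
        field_simp
        ring

/-- **The one-link total-variation contraction, linear form** (Simon 1979, Lemma p. 184:
`‖μ_h − μ_g‖ ≤ ‖h − g‖_∞`; tree `DobrushinMetric.abs_integral_tilted_sub_integral_tilted_le_linear`):
for `osc (log v) ≤ δ`, a boundary change at one plaquette neighbour `y` of `e` moves the law of
`U_e`, tested on bounded measurable `φ` of oscillation `≤ L'`, by at most `(k(e,y) δ / 2) · L'` —
versus `(k(e,y)/(4(d−1))) (e^{4(d−1)δ} − 1) · L'` in `siteLaw_torusWeightSpec_contract`.
[cite: Simon1979Dobrushin, Lemma] -/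
theorem siteLaw_torusWeightSpec_contract_linear {v : G → ℝ} (hv : Continuous v)
    (hv0 : ∀ g, 0 < v g) {δ : ℝ} (hvδ : ∀ a b, |Real.log (v a) - Real.log (v b)| ≤ δ)
    (e : Edge d L) {y : Edge d L} (hy : y ∈ linkNbrT e) {ω η : GaugeConfig d L G}
    (hωη : ∀ z, z ≠ y → ω z = η z) {φ : G → ℝ} (hφm : Measurable φ) (hφb : ∃ M, ∀ s, |φ s| ≤ M)
    {L' : ℝ} (hφL : ∀ a b, |φ a - φ b| ≤ L') :
    |∫ s, φ s ∂(siteLaw (torusWeightSpec v) e ω) - ∫ s, φ s ∂(siteLaw (torusWeightSpec v) e η)| ≤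
      (jointPlaq e y * δ / 2) * L' := by
  have hye : y ≠ e := (mem_linkNbrT_iff.1 hy).1
  rw [siteLaw_torusWeightSpec_eq_tilted_local hv, siteLaw_torusWeightSpec_eq_tilted_local hv]
  -- measurability and boundedness of the local energies
  have hmeas : ∀ τ : GaugeConfig d L G, Measurable fun g =>
      ∑ q ∈ plaqsThrough e, Real.log (v (plaquetteHolonomy (update τ e g) q.1 q.2.1.1 q.2.1.2)) :=
    fun τ => Finset.measurable_sum _ fun q _ =>
      (hv.measurable.comp ((measurable_plaquetteHolonomy _ _ _).comp (measurable_update τ))).log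
  obtain ⟨B, hB⟩ : ∃ B, ∀ g : G, |Real.log (v g)| ≤ B := by
    obtain ⟨C, hC⟩ := isCompact_univ.exists_bound_of_continuousOn
      ((hv.log fun g => (hv0 g).ne').continuousOn)
    exact ⟨C, fun g => by simpa [Real.norm_eq_abs] using hC g (Set.mem_univ g)⟩
  have hbdd : ∀ τ : GaugeConfig d L G, ∃ B', ∀ g : G,
      |∑ q ∈ plaqsThrough e, Real.log (v (plaquetteHolonomy (update τ e g) q.1 q.2.1.1 q.2.1.2))| ≤ B' :=
    fun τ => ⟨∑ _q ∈ plaqsThrough e, B, fun g => (abs_sum_le_sum_abs _ _).trans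
      (sum_le_sum fun q _ => hB _)⟩
  have key := abs_integral_tilted_sub_integral_tilted_le_linear (haarProbability G) (hmeas ω)
    (hmeas η) (hbdd ω) (hbdd η) (κ := 0) (ε := jointPlaq e y * δ)
    (fun g => by rw [sub_zero]; exact abs_localEnergy_sub_le hvδ e hye hωη g) hφm hφb hφL
  refine key.trans_eq ?_
  ring

/-- **Dobrushin's condition (total-variation form), linear coefficients**: for `osc (log v) ≤ δ`
the torus weight specification is a Kantorovich–Rubinstein contraction for the discrete weight
over the plaquette neighbours with coefficients `C e y = k(e,y) δ / 2`, whose row sums are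
`≤ 3(d−1) δ` (`sum_linkNbrT_coeff_le_linear`) — Simon's criterion
`∑_{X ∋ 0} (|X| − 1) ‖Φ(X)‖_∞ < 1` for the plaquette potential read link by link.
[cite: Simon1979Dobrushin, Theorem] -/
theorem isKRContraction_torusWeightSpec_linear {v : G → ℝ} (hv : Continuous v)
    (hv0 : ∀ g, 0 < v g) {δ : ℝ} (hvδ : ∀ a b, |Real.log (v a) - Real.log (v b)| ≤ δ) :
    IsKRContraction (torusWeightSpec (d := d) (L := L) v) (fun _ _ => (1 : ℝ)) linkNbrT
      fun e y => jointPlaq e y * δ / 2 := by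
  have hδ0 : 0 ≤ δ := (abs_nonneg _).trans (hvδ 1 1)
  refine ⟨not_mem_linkNbrT, fun e y => by positivity,
    fun e η η' h => siteLaw_torusWeightSpec_congr hv e h,
    fun e y hy ω η hωη φ L' hφm hφb _hL' hφL => ?_⟩
  rw [mul_one]
  exact siteLaw_torusWeightSpec_contract_linear hv hv0 hvδ e hy hωη hφm hφb
    (fun a b => by simpa using hφL a b)

omit [TopologicalSpace G] [IsTopologicalGroup G] [CompactSpace G] [MeasurableSpace G] [BorelSpace G]
  [SecondCountableTopology G] [Group G] in
/-- Row sums of the linear Dobrushin coefficients: `∑_{y ∈ nbr e} k(e,y) δ / 2 ≤ 3(d−1) δ`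
(`∑_y k(e,y) ≤ 6(d−1)`). [cite: arXiv220412737, §2] -/
theorem sum_linkNbrT_coeff_le_linear {δ : ℝ} (hδ0 : 0 ≤ δ) (e : Edge d L) :
    ∑ y ∈ linkNbrT e, (jointPlaq e y : ℝ) * δ / 2 ≤ 3 * (d - 1 : ℕ) * δ := by
  have hterm : ∀ y, (jointPlaq e y : ℝ) * δ / 2 = (jointPlaq e y : ℝ) * (δ / 2) := fun y => by ring
  simp_rw [hterm, ← sum_mul]
  calc (∑ y ∈ linkNbrT e, (jointPlaq e y : ℝ)) * (δ / 2) ≤ (6 * (d - 1 : ℕ)) * (δ / 2) :=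
        mul_le_mul_of_nonneg_right (sum_jointPlaq_le e) (by positivity)
    _ = 3 * (d - 1 : ℕ) * δ := by ring

end OneLink

end Literature.MathematicalPhysics.QuantumFieldTheory

namespace Literature.MathematicalPhysics.QuantumFieldTheory

open MeasureTheory Filter Topology ProbabilityTheory Function Real Finset
open Literature.Probability.LatticeModels Literature.Probability.LatticeModels.DobrushinMetric
open Literature.MathematicalPhysics.QuantumLattice (toTorusObservable
  IsCylinder IsLocalObservable LGConfig torusLift torusEdge groupHeatKernelMeasure
  groupHeatKernelMeasure_eq groupHeatKernelWeight)

section Profile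

variable {d L : ℕ}

/-- **The distance profile to a set of links** `ℓ(y) = min_{z ∈ Δ} ‖y − z‖_{∞,L}` (base points,
periodic sup-distance): it vanishes on `Δ`, is `1`-Lipschitz along plaquette neighbours, and is
attained (Föllmer 1988, Ch. I, (2.23): the profile in the covariance estimate).
[cite: Follmer1988, Ch. I Theorem (2.13)] -/
theorem exists_linkProfile [NeZero L] (Δ : Finset (Edge d L)) (hΔ : Δ.Nonempty) :
    ∃ ℓ : Edge d L → ℕ, (∀ y ∈ Δ, ℓ y = 0) ∧ (∀ x, ∀ y ∈ linkNbrT x, ℓ x ≤ ℓ y + 1) ∧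
      ∀ y, ∃ z ∈ Δ, torusNorm (y.1 - z.1) ≤ ℓ y := by
  refine ⟨fun y => Δ.inf' hΔ fun z => torusNorm (y.1 - z.1), fun y hy => ?_, fun x y hy => ?_,
    fun y => ?_⟩
  · apply Nat.eq_zero_of_le_zero
    calc Δ.inf' hΔ (fun z => torusNorm (y.1 - z.1)) ≤ torusNorm (y.1 - y.1) := Finset.inf'_le _ hy
      _ = 0 := by rw [sub_self, torusNorm_zero]
  · obtain ⟨z, hz, hzeq⟩ := Finset.exists_mem_eq_inf' hΔ fun z => torusNorm (y.1 - z.1)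
    calc Δ.inf' hΔ (fun z => torusNorm (x.1 - z.1))
        ≤ torusNorm (x.1 - z.1) := Finset.inf'_le _ hz
      _ ≤ torusNorm (x.1 - y.1) + torusNorm (y.1 - z.1) := torusNorm_sub_le _ _ _
      _ ≤ 1 + torusNorm (y.1 - z.1) :=
          Nat.add_le_add_right (torusNorm_sub_le_one_of_mem_linkNbrT hy) _
      _ = Δ.inf' hΔ (fun z => torusNorm (y.1 - z.1)) + 1 := by rw [hzeq]; ring
  · obtain ⟨z, hz, hzeq⟩ := Finset.exists_mem_eq_inf' hΔ fun z => torusNorm (y.1 - z.1)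
    exact ⟨z, hz, hzeq.symm.le⟩

omit L in
/-- `Torus.proj` is additive. [folklore] -/
theorem torusProj_add_zd (L : ℕ) (u w : Literature.Probability.LatticeModels.Site d) :
    Torus.proj L (u + w) = Torus.proj L u + Torus.proj L w := by
  funext i; simp [Torus.proj_apply]

omit L in
/-- `Torus.proj` commutes with negation. [folklore] -/
theorem torusProj_neg_zd (L : ℕ) (u : Literature.Probability.LatticeModels.Site d) :
    Torus.proj L (-u) = -Torus.proj L u := by
  funext i; simp [Torus.proj_apply]

/-- **Separation on the torus**: for a displacement `x` below half the period, the periodic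
sup-distance between the projections of `a` and `b − x` is at least `‖x‖_∞ − ‖a − b‖_∞`. [folklore] -/
theorem supNorm_le_torusNorm_add {x a b : Literature.Probability.LatticeModels.Site d}
    (hx : 2 * Literature.Probability.LatticeModels.Site.supNorm x < L) :
    Literature.Probability.LatticeModels.Site.supNorm x ≤
      torusNorm (Torus.proj L a - Torus.proj L (b - x)) +
        Literature.Probability.LatticeModels.Site.supNorm (a - b) := by
  have h1 : Torus.proj L a - Torus.proj L (b - x) = Torus.proj L (x + (a - b)) := by
    rw [sub_eq_add_neg, ← torusProj_neg_zd, ← torusProj_add_zd]; congr 1; abel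
  have h2 : Torus.proj L x = Torus.proj L (x + (a - b)) + Torus.proj L (-(a - b)) := by
    rw [← torusProj_add_zd]; congr 1; abel
  calc Literature.Probability.LatticeModels.Site.supNorm x = torusNorm (Torus.proj L x) :=
        (torusNorm_proj_eq hx).symm
    _ ≤ torusNorm (Torus.proj L (x + (a - b))) + torusNorm (Torus.proj L (-(a - b))) := by
        rw [h2]; exact torusNorm_add_le _ _
    _ ≤ torusNorm (Torus.proj L a - Torus.proj L (b - x)) +
          Literature.Probability.LatticeModels.Site.supNorm (a - b) := by
        rw [h1, torusProj_neg_zd, torusNorm_neg]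
        exact Nat.add_le_add_left (torusNorm_proj_le _) _

end Profile

section Clustering

variable {d : ℕ} {G : Type*} [Group G] [TopologicalSpace G] [IsTopologicalGroup G]
  [CompactSpace G] [MeasurableSpace G] [BorelSpace G] [SecondCountableTopology G]
  [MeasurableSingletonClass G]

omit [TopologicalSpace G] [IsTopologicalGroup G] [CompactSpace G] [MeasurableSpace G] [BorelSpace G]
  [SecondCountableTopology G] [MeasurableSingletonClass G] [Group G] in
/-- A cylinder observable of `ℤ^d` read through the periodic lift depends only on the projected
links. [folklore] -/
theorem dependsOn_toTorusObservable (L : ℕ) {F : LGConfig d G → ℝ} {Λ : Finset (ZdEdge d)}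
    (hF : IsCylinder F Λ) :
    DependsOn (toTorusObservable L F) (↑(Λ.image (torusEdge L)) : Set (Edge d L)) := by
  intro V V' h
  refine hF fun e he => ?_
  simp only [torusLift, Function.comp_apply]
  exact h _ (by exact_mod_cast mem_image_of_mem _ he)

omit [TopologicalSpace G] [IsTopologicalGroup G] [CompactSpace G] [BorelSpace G]
  [SecondCountableTopology G] [MeasurableSingletonClass G] [Group G] in
/-- A translated cylinder observable read through the periodic lift depends only on the projected
translated links. [folklore] -/
theorem dependsOn_toTorusObservable_configShift (L : ℕ) {F : LGConfig d G → ℝ}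
    {Λ : Finset (ZdEdge d)} (hF : IsCylinder F Λ) (x : Literature.Probability.LatticeModels.Site d) :
    DependsOn (toTorusObservable L (F ∘ QuantumLattice.configShift x))
      (↑(Λ.image fun e => torusEdge L (e.1 - x, e.2)) : Set (Edge d L)) := by
  intro V V' h
  simp only [toTorusObservable, Function.comp_apply]
  refine hF fun e he => ?_
  simp only [QuantumLattice.configShift_apply, torusLift]
  exact h _ (by exact_mod_cast mem_image_of_mem (fun e : ZdEdge d => torusEdge L (e.1 - x, e.2)) he)

omit [TopologicalSpace G] [IsTopologicalGroup G] [CompactSpace G] [MeasurableSpace G] [BorelSpace G]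
  [SecondCountableTopology G] [MeasurableSingletonClass G] in
/-- A bounded function is `2M`-Lipschitz at every link for the discrete weight `r ≡ 1`. [folklore] -/
theorem isLipBound_const_of_abs_le {L : ℕ} {f : GaugeConfig d L G → ℝ} {M : ℝ}
    (hM : ∀ σ, |f σ| ≤ M) : IsLipBound (fun _ _ => (1 : ℝ)) f fun _ => 2 * M := by
  have hM0 : 0 ≤ M := (abs_nonneg _).trans (hM fun _ => 1)
  refine ⟨fun _ => by linarith, fun y σ τ _ => ?_⟩
  rw [mul_one]
  calc |f σ - f τ| ≤ |f σ| + |f τ| := abs_sub _ _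
    _ ≤ M + M := add_le_add (hM σ) (hM τ)
    _ = 2 * M := by ring

/-- **Covariance decay on the torus in Dobrushin's regime** (Föllmer 1988, Ch. I, Thm. (2.13) with
Remark (2.17); Künsch 1982; Georgii 2011, §8.2), for the plaquette-weight measure of a continuous
positive weight `v` with `osc (log v) ≤ δ` and `(3/2)(e^{4(d−1)δ} − 1) ≤ c ≤ 1`: for bounded
measurable `f, g` depending on the link sets `Δf, Δg` and every profile `ℓ` vanishing on `Δg` and
`1`-Lipschitz along plaquette neighbours,
`|∫ f g dμ_v − ∫ f dμ_v ∫ g dμ_v| ≤ 2 (|Δg| · 2M_g) ∑_{y ∈ Δf} c^{ℓ y} · 2M_f`.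
[cite: Follmer1988, Ch. I Theorem (2.13)] -/
theorem abs_integral_mul_sub_le_torusDobrushin (hd : 2 ≤ d) {v : G → ℝ} (hv : Continuous v)
    (hv0 : ∀ g, 0 < v g) {δ : ℝ} (hvδ : ∀ a b, |Real.log (v a) - Real.log (v b)| ≤ δ)
    {c : ℝ} (hc : 3 / 2 * (exp (4 * (d - 1 : ℕ) * δ) - 1) ≤ c) (hc1 : c ≤ 1)
    (L : ℕ) [NeZero L] {f g : GaugeConfig d L G → ℝ} (hfm : Measurable f) {Δf : Finset (Edge d L)}
    (hfdep : DependsOn f (↑Δf : Set (Edge d L))) {Mf : ℝ} (hMf : ∀ σ, |f σ| ≤ Mf)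
    (hgm : Measurable g) {Δg : Finset (Edge d L)} (hgdep : DependsOn g (↑Δg : Set (Edge d L)))
    {Mg : ℝ} (hMg : ∀ σ, |g σ| ≤ Mg) (ℓ : Edge d L → ℕ) (hℓ0 : ∀ y ∈ Δg, ℓ y = 0)
    (hℓ : ∀ x ∉ Δg, ∀ y ∈ linkNbrT x, ℓ x ≤ ℓ y + 1) :
    |(∫ σ, f σ * g σ ∂(groupHeatKernelMeasure (d := d) (L := L) (fun _ : ℝ => v) 0)) -
        (∫ σ, f σ ∂(groupHeatKernelMeasure (d := d) (L := L) (fun _ : ℝ => v) 0)) *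
          ∫ σ, g σ ∂(groupHeatKernelMeasure (d := d) (L := L) (fun _ : ℝ => v) 0)| ≤
      2 * (∑ _y ∈ Δg, 2 * Mg) * ∑ y ∈ Δf, c ^ ℓ y * (2 * Mf) := by
  set μ := groupHeatKernelMeasure (d := d) (L := L) (fun _ : ℝ => v) 0 with hμ
  have hδ0 : 0 ≤ δ := (abs_nonneg _).trans (hvδ 1 1)
  have hc0 : 0 ≤ c := le_trans (by
    have : 0 ≤ exp (4 * (d - 1 : ℕ) * δ) - 1 := sub_nonneg.2 (one_le_exp (by positivity))
    positivity) hc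
  have hγ := isSpecification_torusWeightSpec (d := d) (L := L) hv hv0
  have hC := isKRContraction_torusWeightSpec (L := L) hd hv hv0 hvδ
  have hG := isGibbsMeasure_groupHeatKernelMeasure (d := d) (L := L) hv hv0
  haveI : IsProbabilityMeasure μ := hG.isProbabilityMeasure
  have key := abs_covariance_le_of_isKRContraction hγ hC (r := fun _ _ => (1 : ℝ)) (R := 1)
    (fun _ _ => zero_le_one) (fun _ _ => le_rfl) zero_le_one hc0 hc1
    (fun e => (sum_linkNbrT_coeff_le hd hδ0 e).trans hc) hG hfm hfdep hMf
    (isLipBound_const_of_abs_le hMf) hgm hgdep hMg (isLipBound_const_of_abs_le hMg) ℓ hℓ0 hℓ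
  have hcov : cov[f, g; μ] = (∫ σ, f σ * g σ ∂μ) - (∫ σ, f σ ∂μ) * ∫ σ, g σ ∂μ := by
    rw [covariance_eq_sub]
    · rfl
    · exact memLp_of_bounded (a := -Mf) (b := Mf) (ae_of_all _ fun σ => abs_le.1 (hMf σ))
        hfm.aestronglyMeasurable 2
    · exact memLp_of_bounded (a := -Mg) (b := Mg) (ae_of_all _ fun σ => abs_le.1 (hMg σ))
        hgm.aestronglyMeasurable 2
  rw [hcov] at key
  simpa using key

/-- **Exponential clustering of plaquette-weight torus states in Dobrushin's regime, uniformly in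
the volume and in the displacement** (Dobrushin 1968/1970 uniqueness technique in the
total-variation form, Föllmer 1988 Ch. I Thm. (2.13) with Remark (2.17), Georgii 2011 §8.2, run on
the torus weight specification of `PlaquetteWeightTorusSpecification.lean`): for `2 ≤ d` and
`δ` with Dobrushin constant `c_δ = (3/2)(e^{4(d−1)δ} − 1) < 1` there is a mass
`m = −log max(c_δ, 1/2) > 0` such that for every continuous positive single-plaquette weight `v`
with `osc (log v) ≤ δ`, every weight family `w` with `w 0 = v` and all bounded measurable local
observables `F₁, F₂` of `ℤ^d`, ONE constant `C` bounds
`|⟨F₁ · (F₂ ∘ θ_x)⟩_{L+1} − ⟨F₁⟩_{L+1}⟨F₂ ∘ θ_x⟩_{L+1}| ≤ C e^{−m‖x‖_∞}` for every torus side `L + 1`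
and every displacement with `2‖x‖_∞ < L + 1`. For `d = 4` the hypothesis reads
`osc (log v) < log(5/3)/12 ≈ 4.26·10⁻²` — compare the polydisc `sup|log v| ≤ betaR 1 1296 / 4`
(`≈ 10^(−672.8)`) of `plaquetteWeight_torusClustering_uniform_of_log_le`.
[cite: Follmer1988, Ch. I Theorem (2.13)] [cite: Georgii2011, Thm. 8.7, Thm. 8.20, Remark 8.26, §8.2] -/
theorem plaquetteWeight_torusClustering_dobrushin (hd : 2 ≤ d) {δ : ℝ}
    (hδ : 3 / 2 * (exp (4 * (d - 1 : ℕ) * δ) - 1) < 1) :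
    ∃ m : ℝ, 0 < m ∧ ∀ (v : G → ℝ), Continuous v → (∀ g, 0 < v g) →
      (∀ a b, |Real.log (v a) - Real.log (v b)| ≤ δ) →
      ∀ w : ℝ → G → ℝ, (∀ g, w 0 g = v g) → ∀ F₁ F₂ : LGConfig d G → ℝ,
      IsLocalObservable F₁ → IsLocalObservable F₂ →
      Measurable F₁ → Measurable F₂ → (∃ C, ∀ U, |F₁ U| ≤ C) → (∃ C, ∀ U, |F₂ U| ≤ C) →
      ∃ C : ℝ, ∀ (L : ℕ) (x : Literature.Probability.LatticeModels.Site d), 2 * ‖x‖ < (L : ℝ) + 1 →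
        |(∫ V, toTorusObservable (L + 1) (fun U => F₁ U * F₂ (QuantumLattice.configShift x U)) V
              ∂(groupHeatKernelMeasure (d := d) (L := L + 1) w 0)) -
            (∫ V, toTorusObservable (L + 1) F₁ V
              ∂(groupHeatKernelMeasure (d := d) (L := L + 1) w 0)) *
              ∫ V, toTorusObservable (L + 1) (F₂ ∘ QuantumLattice.configShift x) V
                ∂(groupHeatKernelMeasure (d := d) (L := L + 1) w 0)| ≤
          C * Real.exp (-m * ‖x‖) := by
  -- the Dobrushin constant and the mass
  set c : ℝ := max (3 / 2 * (exp (4 * (d - 1 : ℕ) * δ) - 1)) (1 / 2) with hcdef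
  have hc0 : 0 < c := lt_max_of_lt_right (by norm_num)
  have hc1 : c < 1 := max_lt hδ (by norm_num)
  have hlogc : Real.log c < 0 := Real.log_neg hc0 hc1
  refine ⟨-Real.log c, by linarith, fun v hv hv0 hvδ w hw F₁ F₂ ⟨Λ₁, hΛ₁⟩ ⟨Λ₂, hΛ₂⟩ h₁m h₂m
    ⟨M₁, hM₁⟩ ⟨M₂, hM₂⟩ => ?_⟩
  have hM₁0 : 0 ≤ M₁ := (abs_nonneg _).trans (hM₁ fun _ => 1)
  have hM₂0 : 0 ≤ M₂ := (abs_nonneg _).trans (hM₂ fun _ => 1)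
  -- the diameter of the two supports and the constant
  set D : ℕ := (Λ₁ ×ˢ Λ₂).sup fun ab => Literature.Probability.LatticeModels.Site.supNorm (ab.1.1 - ab.2.1)
    with hDdef
  set K : ℝ := exp (-(D * Real.log c)) with hKdef
  have hK0 : 0 < K := exp_pos _
  refine ⟨2 * (Λ₂.card * (2 * M₂)) * (Λ₁.card * (K * (2 * M₁))), fun L x hx => ?_⟩
  -- the measure depends on `w` only through `w 0 = v`
  have hw' : groupHeatKernelMeasure (d := d) (L := L + 1) w 0 =
      groupHeatKernelMeasure (d := d) (L := L + 1) (fun _ : ℝ => v) 0 := by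
    rw [groupHeatKernelMeasure_eq, groupHeatKernelMeasure_eq]
    simp only [groupHeatKernelWeight, hw]
  rw [hw']
  -- the observables on the torus of side `L + 1`
  set f : GaugeConfig d (L + 1) G → ℝ := toTorusObservable (L + 1) F₁ with hfdef
  set g : GaugeConfig d (L + 1) G → ℝ := toTorusObservable (L + 1) (F₂ ∘ QuantumLattice.configShift x) with hgdef
  have hfm : Measurable f := h₁m.comp (measurable_torusLift (L + 1))
  have hgm : Measurable g := (h₂m.comp (QuantumLattice.configShift x).measurable).comp (measurable_torusLift (L + 1))
  have hfdep := dependsOn_toTorusObservable (G := G) (L + 1) hΛ₁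
  have hgdep := dependsOn_toTorusObservable_configShift (G := G) (L + 1) hΛ₂ x
  have hMf : ∀ σ, |f σ| ≤ M₁ := fun σ => hM₁ _
  have hMg : ∀ σ, |g σ| ≤ M₂ := fun σ => hM₂ _
  have hprod : (fun V => toTorusObservable (L + 1) (fun U => F₁ U * F₂ (QuantumLattice.configShift x U)) V) =
      fun V => f V * g V := rfl
  rw [show (∫ V, toTorusObservable (L + 1) (fun U => F₁ U * F₂ (QuantumLattice.configShift x U)) V
      ∂(groupHeatKernelMeasure (d := d) (L := L + 1) (fun _ : ℝ => v) 0)) =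
      ∫ V, f V * g V ∂(groupHeatKernelMeasure (d := d) (L := L + 1) (fun _ : ℝ => v) 0) from rfl]
  set Δf : Finset (Edge d (L + 1)) := Λ₁.image (torusEdge (L + 1)) with hΔf
  set Δg : Finset (Edge d (L + 1)) := Λ₂.image fun e => torusEdge (L + 1) (e.1 - x, e.2) with hΔg
  have hcle : 3 / 2 * (exp (4 * (d - 1 : ℕ) * δ) - 1) ≤ c := le_max_left _ _
  have hxL : 2 * Literature.Probability.LatticeModels.Site.supNorm x < L + 1 := by
    rw [Literature.Probability.LatticeModels.Site.norm_eq_supNorm] at hx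
    exact_mod_cast hx
  have hexp : Real.exp (-(-Real.log c) * ‖x‖) =
      Real.exp ((Literature.Probability.LatticeModels.Site.supNorm x : ℝ) * Real.log c) := by
    rw [Literature.Probability.LatticeModels.Site.norm_eq_supNorm]; ring_nf
  rw [hexp]
  by_cases hΛ₂ : Λ₂ = ∅
  · -- `F₂` is constant: the covariance vanishes
    have hΔg0 : Δg = ∅ := by rw [hΔg, hΛ₂, image_empty]
    have key := abs_integral_mul_sub_le_torusDobrushin hd hv hv0 hvδ hcle hc1.le (L + 1) hfm hfdep
      hMf hgm hgdep hMg (fun _ => 0) (fun y hy => rfl) (fun _ _ _ _ => Nat.zero_le _)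
    rw [hΔg0, sum_empty, mul_zero, zero_mul] at key
    refine key.trans ?_
    positivity
  -- the distance profile to `Δg`
  have hΔgne : Δg.Nonempty := (nonempty_iff_ne_empty.2 hΛ₂).image _
  obtain ⟨ℓ, hℓ0, hℓ1, hℓ2⟩ := exists_linkProfile Δg hΔgne
  have key := abs_integral_mul_sub_le_torusDobrushin hd hv hv0 hvδ hcle hc1.le (L + 1) hfm hfdep
    hMf hgm hgdep hMg ℓ hℓ0 (fun x' _ y hy => hℓ1 x' y hy)
  refine key.trans ?_
  -- `c ^ ℓ y ≤ K e^{−m ‖x‖}` on `Δf`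
  have hpow : ∀ y ∈ Δf, c ^ ℓ y ≤
      K * Real.exp ((Literature.Probability.LatticeModels.Site.supNorm x : ℝ) * Real.log c) := by
    intro y hy
    obtain ⟨a, ha, rfl⟩ := mem_image.1 hy
    obtain ⟨z, hz, hzle⟩ := hℓ2 (torusEdge (L + 1) a)
    obtain ⟨b, hb, rfl⟩ := mem_image.1 hz
    have hsep := supNorm_le_torusNorm_add (L := L + 1) (a := a.1) (b := b.1) hxL
    have hDab : Literature.Probability.LatticeModels.Site.supNorm (a.1 - b.1) ≤ D := by
      rw [hDdef]
      exact le_sup (f := fun ab : ZdEdge d × ZdEdge d =>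
        Literature.Probability.LatticeModels.Site.supNorm (ab.1.1 - ab.2.1)) (Finset.mk_mem_product ha hb)
    have hineq : (Literature.Probability.LatticeModels.Site.supNorm x : ℝ) ≤ ℓ (torusEdge (L + 1) a) + D := by
      have : Literature.Probability.LatticeModels.Site.supNorm x ≤ ℓ (torusEdge (L + 1) a) + D :=
        hsep.trans (Nat.add_le_add hzle hDab)
      exact_mod_cast this
    rw [hKdef, ← Real.exp_add, ← Real.exp_log hc0, ← Real.exp_nat_mul, Real.exp_log hc0]
    · refine exp_le_exp.2 ?_
      nlinarith
  have hsum : ∑ y ∈ Δf, c ^ ℓ y * (2 * M₁) ≤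
      Λ₁.card * (K * Real.exp ((Literature.Probability.LatticeModels.Site.supNorm x : ℝ) * Real.log c) *
        (2 * M₁)) := by
    calc ∑ y ∈ Δf, c ^ ℓ y * (2 * M₁)
        ≤ ∑ _y ∈ Δf, K * Real.exp ((Literature.Probability.LatticeModels.Site.supNorm x : ℝ) *
            Real.log c) * (2 * M₁) :=
          sum_le_sum fun y hy => mul_le_mul_of_nonneg_right (hpow y hy) (by positivity)
      _ = Δf.card * (K * Real.exp ((Literature.Probability.LatticeModels.Site.supNorm x : ℝ) *
            Real.log c) * (2 * M₁)) := by rw [sum_const, nsmul_eq_mul]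
      _ ≤ Λ₁.card * (K * Real.exp ((Literature.Probability.LatticeModels.Site.supNorm x : ℝ) *
            Real.log c) * (2 * M₁)) := by
          gcongr
          exact card_image_le
  have hsumg : ∑ _y ∈ Δg, 2 * M₂ ≤ Λ₂.card * (2 * M₂) := by
    rw [sum_const, nsmul_eq_mul]
    gcongr
    exact card_image_le
  calc 2 * (∑ _y ∈ Δg, 2 * M₂) * ∑ y ∈ Δf, c ^ ℓ y * (2 * M₁)
      ≤ 2 * (Λ₂.card * (2 * M₂)) * (Λ₁.card * (K * Real.exp
          ((Literature.Probability.LatticeModels.Site.supNorm x : ℝ) * Real.log c) * (2 * M₁))) := by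
        gcongr
    _ = 2 * (Λ₂.card * (2 * M₂)) * (Λ₁.card * (K * (2 * M₁))) *
          Real.exp ((Literature.Probability.LatticeModels.Site.supNorm x : ℝ) * Real.log c) := by ring


/-- **Covariance decay on the torus from a one-link Dobrushin contraction** (Föllmer 1988, Ch. I,
Thm. (2.13) with Remark (2.17); Künsch 1982; Georgii 2011, §8.2) — the coefficient-generic form of
`abs_integral_mul_sub_le_torusDobrushin`: if the torus weight specification of the continuous
positive weight `v` is a KR contraction for the discrete weight over plaquette neighbours with
coefficients `C` of row sums `≤ c ≤ 1`, then for bounded measurable `f, g` depending on the link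
sets `Δf, Δg` and every profile `ℓ` vanishing on `Δg` and `1`-Lipschitz along plaquette neighbours,
`|∫ f g dμ_v − ∫ f dμ_v ∫ g dμ_v| ≤ 2 (|Δg| · 2M_g) ∑_{y ∈ Δf} c^{ℓ y} · 2M_f`.
[cite: Follmer1988, Ch. I Theorem (2.13)] -/
theorem abs_integral_mul_sub_le_torusDobrushin_of_isKRContraction {v : G → ℝ} (hv : Continuous v)
    (hv0 : ∀ g, 0 < v g) (L : ℕ) [NeZero L] {C : Edge d L → Edge d L → ℝ}
    (hC : IsKRContraction (torusWeightSpec (d := d) (L := L) v) (fun _ _ => (1 : ℝ)) linkNbrT C)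
    {c : ℝ} (hc0 : 0 ≤ c) (hc1 : c ≤ 1) (hrow : ∀ e, ∑ y ∈ linkNbrT e, C e y ≤ c)
    {f g : GaugeConfig d L G → ℝ} (hfm : Measurable f) {Δf : Finset (Edge d L)}
    (hfdep : DependsOn f (↑Δf : Set (Edge d L))) {Mf : ℝ} (hMf : ∀ σ, |f σ| ≤ Mf)
    (hgm : Measurable g) {Δg : Finset (Edge d L)} (hgdep : DependsOn g (↑Δg : Set (Edge d L)))
    {Mg : ℝ} (hMg : ∀ σ, |g σ| ≤ Mg) (ℓ : Edge d L → ℕ) (hℓ0 : ∀ y ∈ Δg, ℓ y = 0)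
    (hℓ : ∀ x ∉ Δg, ∀ y ∈ linkNbrT x, ℓ x ≤ ℓ y + 1) :
    |(∫ σ, f σ * g σ ∂(groupHeatKernelMeasure (d := d) (L := L) (fun _ : ℝ => v) 0)) -
        (∫ σ, f σ ∂(groupHeatKernelMeasure (d := d) (L := L) (fun _ : ℝ => v) 0)) *
          ∫ σ, g σ ∂(groupHeatKernelMeasure (d := d) (L := L) (fun _ : ℝ => v) 0)| ≤
      2 * (∑ _y ∈ Δg, 2 * Mg) * ∑ y ∈ Δf, c ^ ℓ y * (2 * Mf) := by
  set μ := groupHeatKernelMeasure (d := d) (L := L) (fun _ : ℝ => v) 0 with hμ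
  have hγ := isSpecification_torusWeightSpec (d := d) (L := L) hv hv0
  have hG := isGibbsMeasure_groupHeatKernelMeasure (d := d) (L := L) hv hv0
  haveI : IsProbabilityMeasure μ := hG.isProbabilityMeasure
  have key := abs_covariance_le_of_isKRContraction hγ hC (r := fun _ _ => (1 : ℝ)) (R := 1)
    (fun _ _ => zero_le_one) (fun _ _ => le_rfl) zero_le_one hc0 hc1 hrow hG hfm hfdep hMf
    (isLipBound_const_of_abs_le hMf) hgm hgdep hMg (isLipBound_const_of_abs_le hMg) ℓ hℓ0 hℓ
  have hcov : cov[f, g; μ] = (∫ σ, f σ * g σ ∂μ) - (∫ σ, f σ ∂μ) * ∫ σ, g σ ∂μ := by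
    rw [covariance_eq_sub]
    · rfl
    · exact memLp_of_bounded (a := -Mf) (b := Mf) (ae_of_all _ fun σ => abs_le.1 (hMf σ))
        hfm.aestronglyMeasurable 2
    · exact memLp_of_bounded (a := -Mg) (b := Mg) (ae_of_all _ fun σ => abs_le.1 (hMg σ))
        hgm.aestronglyMeasurable 2
  rw [hcov] at key
  simpa using key

/-- **Covariance decay on the torus in Simon's linear Dobrushin regime**: as
`abs_integral_mul_sub_le_torusDobrushin` with `3(d−1) δ ≤ c ≤ 1` in place of
`(3/2)(e^{4(d−1)δ} − 1) ≤ c ≤ 1`. [cite: Simon1979Dobrushin, Theorem] -/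
theorem abs_integral_mul_sub_le_torusDobrushin_linear {v : G → ℝ} (hv : Continuous v)
    (hv0 : ∀ g, 0 < v g) {δ : ℝ} (hvδ : ∀ a b, |Real.log (v a) - Real.log (v b)| ≤ δ)
    {c : ℝ} (hc : 3 * (d - 1 : ℕ) * δ ≤ c) (hc1 : c ≤ 1)
    (L : ℕ) [NeZero L] {f g : GaugeConfig d L G → ℝ} (hfm : Measurable f) {Δf : Finset (Edge d L)}
    (hfdep : DependsOn f (↑Δf : Set (Edge d L))) {Mf : ℝ} (hMf : ∀ σ, |f σ| ≤ Mf)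
    (hgm : Measurable g) {Δg : Finset (Edge d L)} (hgdep : DependsOn g (↑Δg : Set (Edge d L)))
    {Mg : ℝ} (hMg : ∀ σ, |g σ| ≤ Mg) (ℓ : Edge d L → ℕ) (hℓ0 : ∀ y ∈ Δg, ℓ y = 0)
    (hℓ : ∀ x ∉ Δg, ∀ y ∈ linkNbrT x, ℓ x ≤ ℓ y + 1) :
    |(∫ σ, f σ * g σ ∂(groupHeatKernelMeasure (d := d) (L := L) (fun _ : ℝ => v) 0)) -
        (∫ σ, f σ ∂(groupHeatKernelMeasure (d := d) (L := L) (fun _ : ℝ => v) 0)) *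
          ∫ σ, g σ ∂(groupHeatKernelMeasure (d := d) (L := L) (fun _ : ℝ => v) 0)| ≤
      2 * (∑ _y ∈ Δg, 2 * Mg) * ∑ y ∈ Δf, c ^ ℓ y * (2 * Mf) := by
  have hδ0 : 0 ≤ δ := (abs_nonneg _).trans (hvδ 1 1)
  have hc0 : 0 ≤ c := le_trans (by positivity) hc
  exact abs_integral_mul_sub_le_torusDobrushin_of_isKRContraction hv hv0 L
    (isKRContraction_torusWeightSpec_linear hv hv0 hvδ) hc0 hc1
    (fun e => (sum_linkNbrT_coeff_le_linear hδ0 e).trans hc) hfm hfdep hMf hgm hgdep hMg ℓ hℓ0 hℓ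

/-- **Exponential clustering of plaquette-weight torus states from ANY one-link Dobrushin
contraction, uniformly in the volume and in the displacement** — the coefficient-generic form of
`plaquetteWeight_torusClustering_dobrushin` (Dobrushin 1968/1970 in the total-variation form,
Föllmer 1988 Ch. I Thm. (2.13) with Remark (2.17); Georgii 2011 §8.2): if for every torus side and
every continuous positive weight `v` with `osc (log v) ≤ δ` the torus weight specification is a KR
contraction for the discrete weight over plaquette neighbours with coefficients `C L` of row sums
`≤ c₀ < 1`, then with `m = −log max(c₀, 1/2)` all bounded measurable local observables cluster at
rate `m`, one constant for every volume and displacement `2‖x‖_∞ < L + 1`. Fed by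
`isKRContraction_torusWeightSpec` (exponential coefficients) or `isKRContraction_torusWeightSpec_linear`
(Simon's linear coefficients). [cite: Follmer1988, Ch. I Theorem (2.13)] -/
theorem plaquetteWeight_torusClustering_of_isKRContraction {δ c₀ : ℝ} (hc₀ : c₀ < 1)
    (Cf : (L : ℕ) → [NeZero L] → Edge d L → Edge d L → ℝ)
    (hC : ∀ (L : ℕ) [NeZero L] (v : G → ℝ), Continuous v → (∀ g, 0 < v g) →
      (∀ a b, |Real.log (v a) - Real.log (v b)| ≤ δ) →
      IsKRContraction (torusWeightSpec (d := d) (L := L) v) (fun _ _ => (1 : ℝ)) linkNbrT (Cf L) ∧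
        ∀ e, ∑ y ∈ linkNbrT e, Cf L e y ≤ c₀) :
    ∃ m : ℝ, 0 < m ∧ ∀ (v : G → ℝ), Continuous v → (∀ g, 0 < v g) →
      (∀ a b, |Real.log (v a) - Real.log (v b)| ≤ δ) →
      ∀ w : ℝ → G → ℝ, (∀ g, w 0 g = v g) → ∀ F₁ F₂ : LGConfig d G → ℝ,
      IsLocalObservable F₁ → IsLocalObservable F₂ →
      Measurable F₁ → Measurable F₂ → (∃ C, ∀ U, |F₁ U| ≤ C) → (∃ C, ∀ U, |F₂ U| ≤ C) →
      ∃ C : ℝ, ∀ (L : ℕ) (x : Literature.Probability.LatticeModels.Site d), 2 * ‖x‖ < (L : ℝ) + 1 →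
        |(∫ V, toTorusObservable (L + 1) (fun U => F₁ U * F₂ (QuantumLattice.configShift x U)) V
              ∂(groupHeatKernelMeasure (d := d) (L := L + 1) w 0)) -
            (∫ V, toTorusObservable (L + 1) F₁ V
              ∂(groupHeatKernelMeasure (d := d) (L := L + 1) w 0)) *
              ∫ V, toTorusObservable (L + 1) (F₂ ∘ QuantumLattice.configShift x) V
                ∂(groupHeatKernelMeasure (d := d) (L := L + 1) w 0)| ≤
          C * Real.exp (-m * ‖x‖) := by
  -- the Dobrushin constant and the mass
  set c : ℝ := max c₀ (1 / 2) with hcdef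
  have hc0 : 0 < c := lt_max_of_lt_right (by norm_num)
  have hc1 : c < 1 := max_lt hc₀ (by norm_num)
  have hlogc : Real.log c < 0 := Real.log_neg hc0 hc1
  refine ⟨-Real.log c, by linarith, fun v hv hv0 hvδ w hw F₁ F₂ ⟨Λ₁, hΛ₁⟩ ⟨Λ₂, hΛ₂⟩ h₁m h₂m
    ⟨M₁, hM₁⟩ ⟨M₂, hM₂⟩ => ?_⟩
  have hM₁0 : 0 ≤ M₁ := (abs_nonneg _).trans (hM₁ fun _ => 1)
  have hM₂0 : 0 ≤ M₂ := (abs_nonneg _).trans (hM₂ fun _ => 1)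
  -- the diameter of the two supports and the constant
  set D : ℕ := (Λ₁ ×ˢ Λ₂).sup fun ab => Literature.Probability.LatticeModels.Site.supNorm (ab.1.1 - ab.2.1)
    with hDdef
  set K : ℝ := exp (-(D * Real.log c)) with hKdef
  have hK0 : 0 < K := exp_pos _
  refine ⟨2 * (Λ₂.card * (2 * M₂)) * (Λ₁.card * (K * (2 * M₁))), fun L x hx => ?_⟩
  -- the measure depends on `w` only through `w 0 = v`
  have hw' : groupHeatKernelMeasure (d := d) (L := L + 1) w 0 =
      groupHeatKernelMeasure (d := d) (L := L + 1) (fun _ : ℝ => v) 0 := by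
    rw [groupHeatKernelMeasure_eq, groupHeatKernelMeasure_eq]
    simp only [groupHeatKernelWeight, hw]
  rw [hw']
  -- the observables on the torus of side `L + 1`
  set f : GaugeConfig d (L + 1) G → ℝ := toTorusObservable (L + 1) F₁ with hfdef
  set g : GaugeConfig d (L + 1) G → ℝ := toTorusObservable (L + 1) (F₂ ∘ QuantumLattice.configShift x) with hgdef
  have hfm : Measurable f := h₁m.comp (measurable_torusLift (L + 1))
  have hgm : Measurable g := (h₂m.comp (QuantumLattice.configShift x).measurable).comp (measurable_torusLift (L + 1))
  have hfdep := dependsOn_toTorusObservable (G := G) (L + 1) hΛ₁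
  have hgdep := dependsOn_toTorusObservable_configShift (G := G) (L + 1) hΛ₂ x
  have hMf : ∀ σ, |f σ| ≤ M₁ := fun σ => hM₁ _
  have hMg : ∀ σ, |g σ| ≤ M₂ := fun σ => hM₂ _
  have hprod : (fun V => toTorusObservable (L + 1) (fun U => F₁ U * F₂ (QuantumLattice.configShift x U)) V) =
      fun V => f V * g V := rfl
  rw [show (∫ V, toTorusObservable (L + 1) (fun U => F₁ U * F₂ (QuantumLattice.configShift x U)) V
      ∂(groupHeatKernelMeasure (d := d) (L := L + 1) (fun _ : ℝ => v) 0)) =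
      ∫ V, f V * g V ∂(groupHeatKernelMeasure (d := d) (L := L + 1) (fun _ : ℝ => v) 0) from rfl]
  set Δf : Finset (Edge d (L + 1)) := Λ₁.image (torusEdge (L + 1)) with hΔf
  set Δg : Finset (Edge d (L + 1)) := Λ₂.image fun e => torusEdge (L + 1) (e.1 - x, e.2) with hΔg
  have hcle : c₀ ≤ c := le_max_left _ _
  obtain ⟨hKR, hrow⟩ := hC (L + 1) v hv hv0 hvδ
  have hxL : 2 * Literature.Probability.LatticeModels.Site.supNorm x < L + 1 := by
    rw [Literature.Probability.LatticeModels.Site.norm_eq_supNorm] at hx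
    exact_mod_cast hx
  have hexp : Real.exp (-(-Real.log c) * ‖x‖) =
      Real.exp ((Literature.Probability.LatticeModels.Site.supNorm x : ℝ) * Real.log c) := by
    rw [Literature.Probability.LatticeModels.Site.norm_eq_supNorm]; ring_nf
  rw [hexp]
  by_cases hΛ₂ : Λ₂ = ∅
  · -- `F₂` is constant: the covariance vanishes
    have hΔg0 : Δg = ∅ := by rw [hΔg, hΛ₂, image_empty]
    have key := abs_integral_mul_sub_le_torusDobrushin_of_isKRContraction hv hv0 (L + 1) hKR hc0.le hc1.le
      (fun e => (hrow e).trans hcle) hfm hfdep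
      hMf hgm hgdep hMg (fun _ => 0) (fun y hy => rfl) (fun _ _ _ _ => Nat.zero_le _)
    rw [hΔg0, sum_empty, mul_zero, zero_mul] at key
    refine key.trans ?_
    positivity
  -- the distance profile to `Δg`
  have hΔgne : Δg.Nonempty := (nonempty_iff_ne_empty.2 hΛ₂).image _
  obtain ⟨ℓ, hℓ0, hℓ1, hℓ2⟩ := exists_linkProfile Δg hΔgne
  have key := abs_integral_mul_sub_le_torusDobrushin_of_isKRContraction hv hv0 (L + 1) hKR hc0.le hc1.le
      (fun e => (hrow e).trans hcle) hfm hfdep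
    hMf hgm hgdep hMg ℓ hℓ0 (fun x' _ y hy => hℓ1 x' y hy)
  refine key.trans ?_
  -- `c ^ ℓ y ≤ K e^{−m ‖x‖}` on `Δf`
  have hpow : ∀ y ∈ Δf, c ^ ℓ y ≤
      K * Real.exp ((Literature.Probability.LatticeModels.Site.supNorm x : ℝ) * Real.log c) := by
    intro y hy
    obtain ⟨a, ha, rfl⟩ := mem_image.1 hy
    obtain ⟨z, hz, hzle⟩ := hℓ2 (torusEdge (L + 1) a)
    obtain ⟨b, hb, rfl⟩ := mem_image.1 hz
    have hsep := supNorm_le_torusNorm_add (L := L + 1) (a := a.1) (b := b.1) hxL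
    have hDab : Literature.Probability.LatticeModels.Site.supNorm (a.1 - b.1) ≤ D := by
      rw [hDdef]
      exact le_sup (f := fun ab : ZdEdge d × ZdEdge d =>
        Literature.Probability.LatticeModels.Site.supNorm (ab.1.1 - ab.2.1)) (Finset.mk_mem_product ha hb)
    have hineq : (Literature.Probability.LatticeModels.Site.supNorm x : ℝ) ≤ ℓ (torusEdge (L + 1) a) + D := by
      have : Literature.Probability.LatticeModels.Site.supNorm x ≤ ℓ (torusEdge (L + 1) a) + D :=
        hsep.trans (Nat.add_le_add hzle hDab)
      exact_mod_cast this
    rw [hKdef, ← Real.exp_add, ← Real.exp_log hc0, ← Real.exp_nat_mul, Real.exp_log hc0]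
    · refine exp_le_exp.2 ?_
      nlinarith
  have hsum : ∑ y ∈ Δf, c ^ ℓ y * (2 * M₁) ≤
      Λ₁.card * (K * Real.exp ((Literature.Probability.LatticeModels.Site.supNorm x : ℝ) * Real.log c) *
        (2 * M₁)) := by
    calc ∑ y ∈ Δf, c ^ ℓ y * (2 * M₁)
        ≤ ∑ _y ∈ Δf, K * Real.exp ((Literature.Probability.LatticeModels.Site.supNorm x : ℝ) *
            Real.log c) * (2 * M₁) :=
          sum_le_sum fun y hy => mul_le_mul_of_nonneg_right (hpow y hy) (by positivity)
      _ = Δf.card * (K * Real.exp ((Literature.Probability.LatticeModels.Site.supNorm x : ℝ) *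
            Real.log c) * (2 * M₁)) := by rw [sum_const, nsmul_eq_mul]
      _ ≤ Λ₁.card * (K * Real.exp ((Literature.Probability.LatticeModels.Site.supNorm x : ℝ) *
            Real.log c) * (2 * M₁)) := by
          gcongr
          exact card_image_le
  have hsumg : ∑ _y ∈ Δg, 2 * M₂ ≤ Λ₂.card * (2 * M₂) := by
    rw [sum_const, nsmul_eq_mul]
    gcongr
    exact card_image_le
  calc 2 * (∑ _y ∈ Δg, 2 * M₂) * ∑ y ∈ Δf, c ^ ℓ y * (2 * M₁)
      ≤ 2 * (Λ₂.card * (2 * M₂)) * (Λ₁.card * (K * Real.exp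
          ((Literature.Probability.LatticeModels.Site.supNorm x : ℝ) * Real.log c) * (2 * M₁))) := by
        gcongr
    _ = 2 * (Λ₂.card * (2 * M₂)) * (Λ₁.card * (K * (2 * M₁))) *
          Real.exp ((Literature.Probability.LatticeModels.Site.supNorm x : ℝ) * Real.log c) := by ring

/-- **Exponential clustering of plaquette-weight torus states in Simon's LINEAR Dobrushin regime,
uniformly in the volume and in the displacement**: as `plaquetteWeight_torusClustering_dobrushin`
with the hypothesis `3(d−1) δ < 1` in place of `(3/2)(e^{4(d−1)δ} − 1) < 1`, mass
`m = −log max(3(d−1)δ, 1/2)`. This is Simon's criterion `∑_{X ∋ 0} (|X| − 1) ‖Φ(X)‖_∞ < 1`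
(Simon 1979, Theorem) for the plaquette potential `Φ_q = log v(U_q)` with the links as sites:
every link lies on `2(d−1)` plaquettes of `3` further links each and `‖log v − const‖_∞ = δ/2`
for `osc (log v) = δ`, so the sum is `2(d−1) · 3 · δ/2 = 3(d−1) δ` (in the tree's bookkeeping:
row sums `∑_y k(e,y) δ/2 ≤ 3(d−1) δ`). For `d = 4`: `osc (log v) < 1/9 ≈ 0.111`
(was `log(5/3)/12 ≈ 4.26·10⁻²`). [cite: Simon1979Dobrushin, Theorem]
[cite: Follmer1988, Ch. I Theorem (2.13)] -/
theorem plaquetteWeight_torusClustering_dobrushin_linear {δ : ℝ} (hδ : 3 * (d - 1 : ℕ) * δ < 1) :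
    ∃ m : ℝ, 0 < m ∧ ∀ (v : G → ℝ), Continuous v → (∀ g, 0 < v g) →
      (∀ a b, |Real.log (v a) - Real.log (v b)| ≤ δ) →
      ∀ w : ℝ → G → ℝ, (∀ g, w 0 g = v g) → ∀ F₁ F₂ : LGConfig d G → ℝ,
      IsLocalObservable F₁ → IsLocalObservable F₂ →
      Measurable F₁ → Measurable F₂ → (∃ C, ∀ U, |F₁ U| ≤ C) → (∃ C, ∀ U, |F₂ U| ≤ C) →
      ∃ C : ℝ, ∀ (L : ℕ) (x : Literature.Probability.LatticeModels.Site d), 2 * ‖x‖ < (L : ℝ) + 1 →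
        |(∫ V, toTorusObservable (L + 1) (fun U => F₁ U * F₂ (QuantumLattice.configShift x U)) V
              ∂(groupHeatKernelMeasure (d := d) (L := L + 1) w 0)) -
            (∫ V, toTorusObservable (L + 1) F₁ V
              ∂(groupHeatKernelMeasure (d := d) (L := L + 1) w 0)) *
              ∫ V, toTorusObservable (L + 1) (F₂ ∘ QuantumLattice.configShift x) V
                ∂(groupHeatKernelMeasure (d := d) (L := L + 1) w 0)| ≤
          C * Real.exp (-m * ‖x‖) :=
  plaquetteWeight_torusClustering_of_isKRContraction hδ (fun L _ e y => jointPlaq e y * δ / 2)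
    fun L hL v hv hv0 hvδ => by
      haveI : NeZero L := hL
      exact ⟨isKRContraction_torusWeightSpec_linear hv hv0 hvδ,
        fun e => sum_linkNbrT_coeff_le_linear ((abs_nonneg _).trans (hvδ 1 1)) e⟩

end Clustering

section ExpWeights

variable {d : ℕ} {G : Type*} [Group G] [TopologicalSpace G] [IsTopologicalGroup G]
  [CompactSpace G] [MeasurableSpace G] [BorelSpace G] [SecondCountableTopology G]
  [MeasurableSingletonClass G]

/-- **Corollary — small continuous plaquette actions (the Osterwalder–Seiler shape).** For `2 ≤ d`
and a coupling `β` with `(3/2)(e^{8(d−1)|β|} − 1) < 1` (`|β| < log(5/3)/(8(d−1))`, `≈ 2.13·10⁻²` for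
`d = 4`; compare `0 ≤ β < betaR 1 (3^d d²)/2 ≈ 10^(−673)` in
`plaquetteWeight_torusClustering_uniform`) there is `m > 0` such that for every continuous
`c : G → ℝ` with `|c| ≤ 1`, every weight family `w` with `w 0 = exp (−β c)` and all bounded
measurable local observables the torus states cluster exponentially, uniformly in the volume and
the displacement: `osc (log w 0) = osc (β c) ≤ 2|β|`, so this is
`plaquetteWeight_torusClustering_dobrushin` with `δ = 2|β|`.
[cite: Follmer1988, Ch. I Theorem (2.13)] -/
theorem plaquetteWeight_torusClustering_dobrushin_exp (hd : 2 ≤ d) {β : ℝ}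
    (hβ : 3 / 2 * (exp (8 * (d - 1 : ℕ) * |β|) - 1) < 1) :
    ∃ m : ℝ, 0 < m ∧ ∀ (c : G → ℝ), Continuous c → (∀ g, |c g| ≤ 1) →
      ∀ w : ℝ → G → ℝ, (∀ g, w 0 g = Real.exp (-(β * c g))) → ∀ F₁ F₂ : LGConfig d G → ℝ,
      IsLocalObservable F₁ → IsLocalObservable F₂ →
      Measurable F₁ → Measurable F₂ → (∃ C, ∀ U, |F₁ U| ≤ C) → (∃ C, ∀ U, |F₂ U| ≤ C) →
      ∃ C : ℝ, ∀ (L : ℕ) (x : Literature.Probability.LatticeModels.Site d), 2 * ‖x‖ < (L : ℝ) + 1 →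
        |(∫ V, toTorusObservable (L + 1) (fun U => F₁ U * F₂ (QuantumLattice.configShift x U)) V
              ∂(groupHeatKernelMeasure (d := d) (L := L + 1) w 0)) -
            (∫ V, toTorusObservable (L + 1) F₁ V
              ∂(groupHeatKernelMeasure (d := d) (L := L + 1) w 0)) *
              ∫ V, toTorusObservable (L + 1) (F₂ ∘ QuantumLattice.configShift x) V
                ∂(groupHeatKernelMeasure (d := d) (L := L + 1) w 0)| ≤
          C * Real.exp (-m * ‖x‖) := by
  have hδ : 3 / 2 * (exp (4 * (d - 1 : ℕ) * (2 * |β|)) - 1) < 1 := by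
    have e : 4 * ((d - 1 : ℕ) : ℝ) * (2 * |β|) = 8 * (d - 1 : ℕ) * |β| := by ring
    rwa [e]
  obtain ⟨m, hm, h⟩ := plaquetteWeight_torusClustering_dobrushin (G := G) hd hδ
  refine ⟨m, hm, fun c hc hc1 w hw => h (fun g => Real.exp (-(β * c g))) ?_ (fun g => exp_pos _) ?_ w hw⟩
  · exact Real.continuous_exp.comp (continuous_const.mul hc).neg
  · intro a b
    rw [Real.log_exp, Real.log_exp]
    have ha := abs_le.1 (hc1 a)
    have hb := abs_le.1 (hc1 b)
    rw [show -(β * c a) - -(β * c b) = β * (c b - c a) by ring, abs_mul]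
    calc |β| * |c b - c a| ≤ |β| * 2 :=
          mul_le_mul_of_nonneg_left (abs_le.2 ⟨by linarith, by linarith⟩) (abs_nonneg β)
      _ = 2 * |β| := by ring


/-- **Corollary — small continuous plaquette actions, linear regime.** For a coupling `β` with
`6(d−1)|β| < 1` (`|β| < 1/18 ≈ 5.6·10⁻²` for `d = 4`; was `log(5/3)/(8(d−1)) ≈ 2.13·10⁻²` in
`plaquetteWeight_torusClustering_dobrushin_exp`) there is `m > 0` such that for every continuous
`c : G → ℝ` with `|c| ≤ 1`, every weight family `w` with `w 0 = exp (−β c)` and all bounded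
measurable local observables the torus states cluster exponentially, uniformly in the volume and
the displacement (`osc (β c) ≤ 2|β|` in `plaquetteWeight_torusClustering_dobrushin_linear`).
[cite: Simon1979Dobrushin, Theorem] [cite: Follmer1988, Ch. I Theorem (2.13)] -/
theorem plaquetteWeight_torusClustering_dobrushin_exp_linear {β : ℝ}
    (hβ : 6 * (d - 1 : ℕ) * |β| < 1) :
    ∃ m : ℝ, 0 < m ∧ ∀ (c : G → ℝ), Continuous c → (∀ g, |c g| ≤ 1) →
      ∀ w : ℝ → G → ℝ, (∀ g, w 0 g = Real.exp (-(β * c g))) → ∀ F₁ F₂ : LGConfig d G → ℝ,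
      IsLocalObservable F₁ → IsLocalObservable F₂ →
      Measurable F₁ → Measurable F₂ → (∃ C, ∀ U, |F₁ U| ≤ C) → (∃ C, ∀ U, |F₂ U| ≤ C) →
      ∃ C : ℝ, ∀ (L : ℕ) (x : Literature.Probability.LatticeModels.Site d), 2 * ‖x‖ < (L : ℝ) + 1 →
        |(∫ V, toTorusObservable (L + 1) (fun U => F₁ U * F₂ (QuantumLattice.configShift x U)) V
              ∂(groupHeatKernelMeasure (d := d) (L := L + 1) w 0)) -
            (∫ V, toTorusObservable (L + 1) F₁ V
              ∂(groupHeatKernelMeasure (d := d) (L := L + 1) w 0)) *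
              ∫ V, toTorusObservable (L + 1) (F₂ ∘ QuantumLattice.configShift x) V
                ∂(groupHeatKernelMeasure (d := d) (L := L + 1) w 0)| ≤
          C * Real.exp (-m * ‖x‖) := by
  have hδ : 3 * (d - 1 : ℕ) * (2 * |β|) < 1 := by
    have e : 3 * ((d - 1 : ℕ) : ℝ) * (2 * |β|) = 6 * (d - 1 : ℕ) * |β| := by ring
    rwa [e]
  obtain ⟨m, hm, h⟩ := plaquetteWeight_torusClustering_dobrushin_linear (G := G) hδ
  refine ⟨m, hm, fun c hc hc1 w hw => h (fun g => Real.exp (-(β * c g))) ?_ (fun g => exp_pos _) ?_ w hw⟩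
  · exact Real.continuous_exp.comp (continuous_const.mul hc).neg
  · intro a b
    rw [Real.log_exp, Real.log_exp]
    have ha := abs_le.1 (hc1 a)
    have hb := abs_le.1 (hc1 b)
    rw [show -(β * c a) - -(β * c b) = β * (c b - c a) by ring, abs_mul]
    calc |β| * |c b - c a| ≤ |β| * 2 :=
          mul_le_mul_of_nonneg_left (abs_le.2 ⟨by linarith, by linarith⟩) (abs_nonneg β)
      _ = 2 * |β| := by ring

end ExpWeights

end Literature.MathematicalPhysics.QuantumFieldTheory
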